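import Summits.Ventures.Crystal3D.Theorems.StickyWulffConstantGenericWallFloorInPlaneSlots
import HarnessLib

/-!
# The in-plane slot step at a twin-dozen ball keeps three independent exact slot neighbours

HONEST FRAMING. Venture `Summits/Ventures/Crystal3D` (cell `crystal3d-full`), helper for the crux
`GenericWallFloor` (stmt-Ventures-19480) of `route-Ventures-StickyWulffConstant`, REGISTERED line `WallLedgerG`,
open stub `stub_twoSlabAdhesion` (general fillings; coherent-walk engine, memos LINES-FLOOR-ARCH v3/v4 on the
item).  Rung credit only; F-C1 not moved.

With `…DozenStep` (`exists_exact_neighbours_fcc_step`, `exists_exact_neighbours_twin_step`) and `…LineRise`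
(`exists_exact_neighbours_nearPolar_step`) this file completes the list: at a twin-dozen ball `y` (frame `A`,
normal `n`, own side occupied) a step along an IN-PLANE slot `u` (`⟪A u, n⟫ = 0`) also lands on a ball with
three linearly independent exact `A`-slot neighbours (`exists_exact_neighbours_inPlane_step`).  So from a
full-shell ball EVERY one of the twelve slot steps, and from a twin-dozen ball EVERY one of its twelve dozen
moves (six in-plane, three near-polar, three mirror), preserves the walk invariant «three independent exact slot
neighbours» (in the twin frame after a mirror move) — the walker may steer freely among all twelve neighbours.
Proof: `u = a − b` for near-polar `a, b` (`inPlane_eq_sub_of_nearPolar`); with the third near-polar slot `c` the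
slots `−u, b − c, b` are independent and lead from `y + A u` to `y`, `y + A (a − c)`, `y + A a` (own side).
WHAT THIS IS NOT: not the stub; F-C1 not moved.
-/

noncomputable section

namespace Summit.Ventures.Crystal3D.Theorems

open Summit.Ventures.Crystal3D Finset
open Literature.MathematicalPhysics.StatisticalMechanics (fccStacking)
open scoped InnerProductSpace

variable {X : Finset (EuclideanSpace ℝ (Fin 3))}

/-- Independence of `b − a, b − c, b` for unit vectors `a, b, c` at pairwise inner product `1/2`. -/
theorem linearIndependent_sub_sub_self {a b c : EuclideanSpace ℝ (Fin 3)} (ha : ‖a‖ = 1) (hb : ‖b‖ = 1)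
    (hc : ‖c‖ = 1) (hab : ⟪a, b⟫_ℝ = 1 / 2) (hac : ⟪a, c⟫_ℝ = 1 / 2) (hbc : ⟪b, c⟫_ℝ = 1 / 2) :
    LinearIndependent ℝ ![b - a, b - c, b] := by
  rw [Fintype.linearIndependent_iff]
  intro g hg
  have haa : ⟪a, a⟫_ℝ = 1 := by rw [real_inner_self_eq_norm_sq, ha, one_pow]
  have hbb : ⟪b, b⟫_ℝ = 1 := by rw [real_inner_self_eq_norm_sq, hb, one_pow]
  have hcc : ⟪c, c⟫_ℝ = 1 := by rw [real_inner_self_eq_norm_sq, hc, one_pow]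
  have hba : ⟪b, a⟫_ℝ = 1 / 2 := by rw [real_inner_comm, hab]
  have hca : ⟪c, a⟫_ℝ = 1 / 2 := by rw [real_inner_comm, hac]
  have hcb : ⟪c, b⟫_ℝ = 1 / 2 := by rw [real_inner_comm, hbc]
  rw [Fin.sum_univ_three] at hg
  simp only [Matrix.cons_val_zero, Matrix.cons_val_one, Matrix.cons_val] at hg
  have e1 := congrArg (fun v => ⟪a, v⟫_ℝ) hg
  have e2 := congrArg (fun v => ⟪b, v⟫_ℝ) hg
  have e3 := congrArg (fun v => ⟪c, v⟫_ℝ) hg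
  simp only [inner_add_right, inner_smul_right, inner_sub_right, inner_zero_right, haa, hbb, hcc, hab, hac,
    hbc, hba, hca, hcb] at e1 e2 e3
  intro i
  fin_cases i <;> simp <;> linarith

/-- The in-plane step, for a labelled near-polar triple `a, b, c` with `u = a − b`. -/
theorem exists_exact_neighbours_inPlane_step_aux
    (A : EuclideanSpace ℝ (Fin 3) ≃ₗᵢ[ℝ] EuclideanSpace ℝ (Fin 3)) {y n u a b c : EuclideanSpace ℝ (Fin 3)}
    (hy : y ∈ X) (hn : ‖n‖ = 1)
    (hown : ∀ w ∈ fccSlots, ⟪A w, n⟫_ℝ ≤ 0 → y + A w ∈ X)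
    (hu : u ∈ fccSlots) (ha : a ∈ fccSlots) (hb : b ∈ fccSlots) (hc : c ∈ fccSlots)
    (hab : a ≠ b) (hac : a ≠ c) (hbc : b ≠ c)
    (hna : ⟪A a, n⟫_ℝ = -Real.sqrt (2 / 3)) (hnb : ⟪A b, n⟫_ℝ = -Real.sqrt (2 / 3))
    (hnc : ⟪A c, n⟫_ℝ = -Real.sqrt (2 / 3)) (huab : u = a - b) :
    ∃ a' ∈ fccSlots, ∃ b' ∈ fccSlots, ∃ c' ∈ fccSlots, LinearIndependent ℝ ![a', b', c'] ∧
      y + A u + A a' ∈ X ∧ y + A u + A b' ∈ X ∧ y + A u + A c' ∈ X := by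
  have hrpos : 0 < Real.sqrt (2 / 3) := Real.sqrt_pos.2 (by norm_num)
  have ha1 := norm_eq_one_of_mem_fccSlots ha
  have hb1 := norm_eq_one_of_mem_fccSlots hb
  have hc1 := norm_eq_one_of_mem_fccSlots hc
  have slotA : ∀ {w}, w ∈ fccSlots → A w ∈ A '' fccStacking 1 (Real.sqrt (2 / 3)) ∧ ‖A w‖ = 1 :=
    fun hw => ⟨⟨_, mem_fcc_of_mem_fccSlots hw, rfl⟩,
      by rw [LinearIsometryEquiv.norm_map, norm_eq_one_of_mem_fccSlots hw]⟩
  have hpair : ∀ {a b}, a ∈ fccSlots → b ∈ fccSlots → a ≠ b → ⟪A a, n⟫_ℝ = -Real.sqrt (2 / 3) →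
      ⟪A b, n⟫_ℝ = -Real.sqrt (2 / 3) → ⟪a, b⟫_ℝ = 1 / 2 := by
    intro a b ha hb hab han hbn
    have h := inner_eq_half_of_far_slots A (n := -n) (slotA ha).1 (slotA hb).1 (slotA ha).2 (slotA hb).2
      (by rw [norm_neg, hn]) (by rw [inner_neg_right, han, neg_neg]) (by rw [inner_neg_right, hbn, neg_neg])
      (fun e => hab (A.injective e))
    rwa [LinearIsometryEquiv.inner_map_map] at h
  have iab := hpair ha hb hab hna hnb
  have iac := hpair ha hc hac hna hnc
  have ibc := hpair hb hc hbc hnb hnc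
  -- the three slots
  have s1 : -u ∈ fccSlots := neg_mem_fccSlots hu
  have s2 : b - c ∈ fccSlots := by
    refine mem_fccSlots_of_unit ?_ ?_
    · rw [sub_eq_add_neg]
      exact fcc_add_site_mem (mem_fcc_of_mem_fccSlots hb) (mem_fcc_of_mem_fccSlots (neg_mem_fccSlots hc))
    · have : ‖b - c‖ ^ 2 = 1 := by rw [norm_sub_sq_real, hb1, hc1, ibc]; norm_num
      nlinarith [norm_nonneg (b - c)]
  have s2' : a - c ∈ fccSlots := by
    refine mem_fccSlots_of_unit ?_ ?_
    · rw [sub_eq_add_neg]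
      exact fcc_add_site_mem (mem_fcc_of_mem_fccSlots ha) (mem_fcc_of_mem_fccSlots (neg_mem_fccSlots hc))
    · have : ‖a - c‖ ^ 2 = 1 := by rw [norm_sub_sq_real, ha1, hc1, iac]; norm_num
      nlinarith [norm_nonneg (a - c)]
  refine ⟨-u, s1, b - c, s2, b, hb, ?_, ?_, ?_, ?_⟩
  · have e : (![-u, b - c, b] : Fin 3 → EuclideanSpace ℝ (Fin 3)) = ![b - a, b - c, b] := by
      rw [huab, neg_sub]
    rw [e]; exact linearIndependent_sub_sub_self ha1 hb1 hc1 iab iac ibc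
  · rw [map_neg, add_neg_cancel_right]; exact hy
  · rw [add_assoc, ← map_add, huab, show a - b + (b - c) = a - c by abel]
    exact hown _ s2' (by rw [map_sub, inner_sub_left, hna, hnc, sub_self])
  · rw [add_assoc, ← map_add, huab, sub_add_cancel]
    exact hown _ ha (by rw [hna]; linarith)

/-- **In-plane slot step.**  At a twin-dozen ball `y` (frame `A`, unit `{111}` normal `n`, own side
occupied), for an in-plane slot `u` (`⟪A u, n⟫ = 0`) the ball `y + A u` has three linearly independent exact
slot neighbours in the frame `A`. -/
theorem exists_exact_neighbours_inPlane_step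
    (A : EuclideanSpace ℝ (Fin 3) ≃ₗᵢ[ℝ] EuclideanSpace ℝ (Fin 3)) {y n u : EuclideanSpace ℝ (Fin 3)}
    (hy : y ∈ X) (hn : ‖n‖ = 1)
    (hmenu : ∀ w ∈ fccSlots, ⟪A w, n⟫_ℝ = 0 ∨ ⟪A w, n⟫_ℝ = Real.sqrt (2 / 3) ∨ ⟪A w, n⟫_ℝ = -Real.sqrt (2 / 3))
    (hown : ∀ w ∈ fccSlots, ⟪A w, n⟫_ℝ ≤ 0 → y + A w ∈ X)
    (hu : u ∈ fccSlots) (hun : ⟪A u, n⟫_ℝ = 0) :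
    ∃ a ∈ fccSlots, ∃ b ∈ fccSlots, ∃ c ∈ fccSlots, LinearIndependent ℝ ![a, b, c] ∧
      y + A u + A a ∈ X ∧ y + A u + A b ∈ X ∧ y + A u + A c ∈ X := by
  have hu1 := norm_eq_one_of_mem_fccSlots hu
  have hn' : ‖-n‖ = 1 := by rw [norm_neg, hn]
  have hmenu' : ∀ w ∈ fccSlots, ⟪A w, -n⟫_ℝ = 0 ∨ ⟪A w, -n⟫_ℝ = Real.sqrt (2 / 3) ∨
      ⟪A w, -n⟫_ℝ = -Real.sqrt (2 / 3) := by
    intro w hw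
    rcases hmenu w hw with h | h | h
    · exact Or.inl (by rw [inner_neg_right, h, neg_zero])
    · exact Or.inr (Or.inr (by rw [inner_neg_right, h]))
    · exact Or.inr (Or.inl (by rw [inner_neg_right, h, neg_neg]))
  obtain ⟨w₁, hw₁, w₂, hw₂, w₃, hw₃, h12, h13, h23, e₁, e₂, e₃⟩ := exists_three_far_slots A hn' hmenu'
  rw [inner_neg_right, neg_eq_iff_eq_neg] at e₁ e₂ e₃
  obtain ⟨a, ha, b, hb, hab⟩ := inPlane_eq_sub_of_nearPolar A hn hmenu hu hun hw₁ hw₂ hw₃ h12 h13 h23 e₁ e₂ e₃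
  have nondeg : a ≠ b := by
    intro h; rw [h, sub_self] at hab; rw [hab, norm_zero] at hu1; norm_num at hu1
  simp only [Finset.mem_insert, Finset.mem_singleton] at ha hb
  rcases ha with rfl | rfl | rfl <;> rcases hb with rfl | rfl | rfl
  · exact absurd rfl nondeg
  · exact exists_exact_neighbours_inPlane_step_aux A hy hn hown hu hw₁ hw₂ hw₃ h12 h13 h23 e₁ e₂ e₃ hab
  · exact exists_exact_neighbours_inPlane_step_aux A hy hn hown hu hw₁ hw₃ hw₂ h13 h12 h23.symm e₁ e₃ e₂ hab
  · exact exists_exact_neighbours_inPlane_step_aux A hy hn hown hu hw₂ hw₁ hw₃ h12.symm h23 h13 e₂ e₁ e₃ hab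
  · exact absurd rfl nondeg
  · exact exists_exact_neighbours_inPlane_step_aux A hy hn hown hu hw₂ hw₃ hw₁ h23 h12.symm h13.symm e₂ e₃ e₁ hab
  · exact exists_exact_neighbours_inPlane_step_aux A hy hn hown hu hw₃ hw₁ hw₂ h13.symm h23.symm h12 e₃ e₁ e₂ hab
  · exact exists_exact_neighbours_inPlane_step_aux A hy hn hown hu hw₃ hw₂ hw₁ h23.symm h13.symm h12.symm e₃ e₂ e₁ hab
  · exact absurd rfl nondeg

end Summit.Ventures.Crystal3D.Theorems

end
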